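import Mathlib
import HarnessLib
import Summits.KontsevichZagierPeriods.KontsevichZagierPeriods.Theses.FurushoPentagon
import Summits.KontsevichZagierPeriods.KontsevichZagierPeriods.Theorems.FurushoPentagonKernelModuloPeriodConjectureMzvSectorTransfer

/-!
# `KernelModuloPeriodConjecture`, line `Sketch`: the crux from its two leaves (split glue)

Crux `FurushoPentagon.KernelModuloPeriodConjecture` (stmt-KontsevichZagierPeriods-15058,
`MzvPeriodConjecture → PentagonInKZ → ReducedPeriodRing → SectorToKernel`), line `Sketch`.
With the MZV-sector transfer landed (`mzvSectorKernel_of`,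
`Theorems/FurushoPentagonKernelModuloPeriodConjectureMzvSectorTransfer.lean`), the crux follows from
exactly its two open leaves — the algebraic leaf `AssociatorHoffmanSpanning` (Hoffman words span
`𝒪(GroupLike ∩ Pent)_red` weight by weight; the coordinate form of `GRT₁ ≅ U^{dR}_{MT(ℤ)}`, open)
and the off-sector complement `OffMzvSectorComplement` (Conjecture 1 off the multiple-zeta sector,
not claimed) — both spelled out as hypotheses: this is the glue
`AssociatorHoffmanSpanning → OffMzvSectorComplement → KernelModuloPeriodConjecture` of the route
header's prepared glued split, now a theorem (`kernelModuloPeriodConjecture_of_leaves`; registered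
sub-goal `stub_splitGlue`). The inner antecedents `StuffleInKZ`, `HoffmanRelationInKZ` of
`SectorToKernel` are not used.

References: M. Kontsevich, D. Zagier, *Periods* (2001), §1.2 [KontsevichZagier2001]; H. Furusho,
Ann. of Math. 174 (2011), Thm 1.2 [Furusho2011]; F. Brown, Ann. of Math. 175 (2012), Thm 1.1
[Brown2012].
-/

noncomputable section

namespace Summit.KontsevichZagierPeriods.FurushoPentagon.KernelModuloPeriodConjecture

open Literature.NumberTheory.Transcendental
open Literature.NumberTheory.Transcendental.KZ
open Summit.KontsevichZagierPeriods.KontsevichZagierPeriods.Theses.FurushoPentagon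

/-- **Registered sub-goal `stub_splitGlue`: the crux from its two leaves.** The algebraic leaf
(`AssociatorHoffmanSpanning`, spelled out) and the off-sector complement (`OffMzvSectorComplement`,
spelled out) imply `KernelModuloPeriodConjecture`: feed `MzvPeriodConjecture`, `PentagonInKZ`,
`ReducedPeriodRing` and the leaf to the landed sector transfer `mzvSectorKernel_of`, then apply the
complement. [cite: KontsevichZagier2001, §1.2] -/
theorem stub_splitGlue :
    (∀ s : List ℕ, MZV.IsAdmissible s → ∃ b : List ℕ →₀ ℚ, (∀ t ∈ b.support, MZV.IsHoffman t ∧ MZV.weight t = MZV.weight s) ∧ ∀ (R : Type) [CommRing R] [Algebra ℚ R] [IsReduced R] (φ : NCSeries Bool R), NCSeries.IsGroupLike φ → NCSeries.DrinfeldPentagon φ → φ (MZV.binaryWord s) = b.sum (fun t q => q • φ (MZV.binaryWord t))) → ((∀ c ∈ AddSubgroup.closure (Set.range (fun s : {s : List ℕ // MZV.IsAdmissible s} => KZ.of (KZ.mzvRep s.1 s.2 (KZ.mzvIntegrand_isSemialgebraicFunOn_holds s.1) (KZ.mzvIntegrand_integrableOn_holds s.1 s.2)))), KZ.eval c = 0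 → c ∈ KZ.relations) → ∀ c : KZ.FormalRep, KZ.eval c = 0 → c ∈ KZ.relations) → Summit.KontsevichZagierPeriods.KontsevichZagierPeriods.Theses.FurushoPentagon.KernelModuloPeriodConjecture :=
  fun hA hO hZ hP hR _ _ => hO (mzvSectorKernel_of hP hR hA hZ)

/-- **The crux from its two leaves** (glue of the prepared split
`KernelModuloPeriodConjecture ⇐ AssociatorHoffmanSpanning → OffMzvSectorComplement`, with both
leaves as explicit hypotheses). [cite: KontsevichZagier2001, §1.2] -/
theorem kernelModuloPeriodConjecture_of_leaves
    (hA : ∀ s : List ℕ, MZV.IsAdmissible s → ∃ b : List ℕ →₀ ℚ, (∀ t ∈ b.support, MZV.IsHoffman t ∧ MZV.weight t = MZV.weight s) ∧ ∀ (R : Type) [CommRing R] [Algebra ℚ R] [IsReduced R] (φ : NCSeries Bool R), NCSeries.IsGroupLike φ → NCSeries.DrinfeldPentagon φ → φ (MZV.binaryWord s) = b.sum (fun t q => q • φ (MZV.binaryWord t)))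
    (hO : (∀ c ∈ AddSubgroup.closure (Set.range (fun s : {s : List ℕ // MZV.IsAdmissible s} => KZ.of (KZ.mzvRep s.1 s.2 (KZ.mzvIntegrand_isSemialgebraicFunOn_holds s.1) (KZ.mzvIntegrand_integrableOn_holds s.1 s.2)))), KZ.eval c = 0 → c ∈ KZ.relations) → ∀ c : KZ.FormalRep, KZ.eval c = 0 → c ∈ KZ.relations) :
    KernelModuloPeriodConjecture :=
  stub_splitGlue hA hO

end Summit.KontsevichZagierPeriods.FurushoPentagon.KernelModuloPeriodConjecture

end
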